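import Literature.CategoryTheory.Preadditive.EvansCancellation
import Literature.CategoryTheory.Preadditive.FullFunctorNilKernel
import Mathlib.CategoryTheory.Idempotents.Biproducts
import HarnessLib

/-!
# Krull–Schmidt in the Karoubi (pseudo-abelian) envelope (André–Kahn §1.2.2, Cor. 1.4.5, Prop. 2.3.4 c); Krause Cor. 4.4;
# Shah Def. 3.8, Prop. 3.10, Thm. 6.1)

Family `hodge`, lane `lit-hodgefound` (foundations library; seat `lit-hodgefound-p39`, generation 37, row g37-#5); topic
`CategoryTheory/Preadditive`, namespace `Literature.CategoryTheory.KrullSchmidt` — sequel of g37-#2 `KrullSchmidtSemiperfect`, g37-#3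
`FullFunctorNilKernel`, g37-#4 `EvansCancellation`.  Object-wise form of «the pseudo-abelian envelope of a `Hom`-finite additive category is a
Krull–Schmidt category» for Mathlib's `Karoubi C` — the construction by which Chow ∕ homological ∕ numerical motives are MADE from the
category of correspondences: an object `P = (X, p)` of `Karoubi C` has `End P = p · End_C(X) · p`, a CORNER of `End_C(X)`; corners of
semiperfect rings are semiperfect (AF 27.7, g37-#1), so `P` inherits the Krull–Remak–Schmidt theorem (g37-#2) and Evans cancellation (g37-#4)
from hypotheses on `End_C(X)` alone (semiperfect; left artinian; finite-dimensional over a field).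

Sources, verbatim.  André–Kahn [AndreKahn2002Nilpotence]: §1.1 «une `K`-catégorie `𝒜` est pseudo-abélienne si tout projecteur a un noyau …
une catégorie pseudo-abélienne est souvent appelée karoubienne»; «son enveloppe pseudo-abélienne `𝒜♮` (scindage d'idempotents …)»; **§1.2.2**
«Les objets sont les couples `(A,e)` avec `A ∈ 𝒜` et `e ∈ 𝒜(A,A)` vérifiant `e² = e`. Pour un autre tel couple `(B,f)`, on pose
`𝒜♮((A,e),(B,f)) = f𝒜(A,B)e ⊂ 𝒜(A,B)`.»; **Cor. 1.4.5** «Les radicaux des catégories `𝒜, 𝒜^⊕, 𝒜♮` et `𝒜^{⊕♮}` se correspondent»;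
**Prop. 2.3.4 c)** «La notion de `K`-catégorie semi-primaire est Morita-invariante. En particulier, si `𝒜` est semi-primaire, alors `𝒜^⊕, 𝒜♮,
𝒜^{⊕♮}` le sont (et réciproquement).», **d)** «si `𝒜(A,A)` est un anneau artinien pour tout `A ∈ 𝒜`, alors `𝒜` est semi-primaire».  Krause
[Krause2015KS, Cor. 4.4]: «An additive category is a Krull-Schmidt category if and only if it has split idempotents and the endomorphism
ring of every object is semi-perfect.»  Shah [Shah2023KRS]: Def. 3.8 (split idempotents), «any additive category embeds into one that has
split idempotents; see Karoubi», Thm. 6.1 («Let `𝒜` be a `Hom`-finite `k`-linear category. … (1) `𝒜` is a Krull-Schmidt category. (2) `𝒜` has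
split idempotents. (3) … `End_𝒜(Y)` is local if and only if `Y` is indecomposable»).

## What is formalised (`C` preadditive; `Karoubi C` Mathlib's idempotent completion, `P.X`, `P.p`)

* §1 **AK §1.2.2: `End P ≃+* p·End_C(P.X)·p`** (`nonempty_end_karoubi_ringEquiv_corner`), fully faithful additive functors induce
  `End X ≃+* End (F X)` (`nonempty_end_ringEquiv_of_full_of_faithful`; `toKaroubi`); hence **`End P` semiperfect ∕ left artinian when
  `End_C(P.X)` is** (`isSemiperfectRing_end_karoubi`, `isArtinianRing_end_karoubi`, finite-dimensional form).
* §2 **KRULL–REMAK–SCHMIDT IN `Karoubi C`** (finite biproducts in `C`; `[HasBinaryBiproducts (Karoubi C)]` taken as a hypothesis since Mathlib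
  keeps `hasBinaryBiproducts_of_finite_biproducts` a non-instance): every `P` with `End_C(P.X)` semiperfect ∕ artinian ∕ finite-dimensional
  is a finite biproduct of indecomposables with local endomorphism rings, uniquely (`krullRemakSchmidt_karoubi…`); `P` indecomposable ⟺
  `End P` local; the image `(X, 𝟙)` of `X : C` decomposes in `Karoubi C` (`exists_iso_biproduct_indecomposable_toKaroubi`).
* §3 **Evans cancellation in `Karoubi C`**: `P ⊞ Q ≅ P ⊞ Q′ ⟹ Q ≅ Q′` for `End_C(P.X)` semiperfect ∕ artinian ∕ finite-dimensional.
* §4 `toKaroubi C` reflects isomorphisms classes and indecomposability (g37-#3 with zero kernel): `X ≅ Y ⟺ (X,1) ≅ (Y,1)`;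
  `(X,1)` indecomposable ⟹ `X` indecomposable, and conversely when `C` already has split idempotents.

Theorems only, 0 `sorry`, no definition, no named fact (net debt 0, D-0026), no instance, no notation.

## Mathlib / Literature search

Mathlib: `Karoubi C` with `Preadditive`, `IsIdempotentComplete`, `karoubi_hasFiniteBiproducts` (instance), `Karoubi.Hom` (`f`, `comm`,
`p_comp`, `comp_p`, `hom_ext`, `comp_f`, `id_f`), `toKaroubi` (full, faithful, additive), `Karoubi.decompId_i ∕ _p ∕ decompId`,
`RingEquiv.ofBijective`, `RingEquiv.isArtinianRing`; no `Linear k (Karoubi C)` instance and no Krull–Schmidt statement for `Karoubi`.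
Literature: p08 `Corner.isArtinianRing`; g37-#1 `Corner.isSemiperfectRing`, `isSemiperfectRing_of_isArtinianRing`; g37-#2
`isSemiperfectRing_of_ringEquiv`, `krullRemakSchmidt_of_isSemiperfectRing`, `indecomposable_iff_isLocalRing_end_of_isSemiperfectRing`,
`exists_iso_biproduct_indecomposable_of_isSemiperfectRing`; g37-#3 `nonempty_iso_iff`, `indecomposable_of_indecomposable_obj`,
`indecomposable_iff_indecomposable_obj`; g37-#4 `nonempty_iso_of_biprod_iso_biprod_of_isSemiperfectRing_end`.

## References

* Y. André, B. Kahn, *Nilpotence, radicaux et structures monoïdales*, Rend. Sem. Mat. Univ. Padova 108 (2002): §1.1, §1.2.2, Cor. 1.4.5,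
  Prop. 2.3.4 c), d). [AndreKahn2002Nilpotence]
* H. Krause, *Krull–Schmidt categories and projective covers*, Expo. Math. 33 (2015): Cor. 4.4, Thm. 4.2. [Krause2015KS]
* A. Shah, *Krull–Remak–Schmidt decompositions in Hom-finite additive categories*, Expo. Math. 41 (2023): Def. 3.8, Prop. 3.10, Thm. 6.1.
  [Shah2023KRS]
* T. Y. Lam, *A First Course in Noncommutative Rings*, 2nd ed. (2001): §20 Thm. (20.11), §21 (21.13), §23. [Lam2001FirstCourse]
-/

open CategoryTheory CategoryTheory.Limits CategoryTheory.Idempotents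

namespace Literature.CategoryTheory.KrullSchmidt

open Literature.RingTheory.Idempotents (IsSemiperfectRing)

universe v v' u u'

variable {C : Type u} [Category.{v} C] [Preadditive C]

/-! ## §1 Endomorphism rings in the Karoubi envelope: `End (X, p) = p End(X) p` -/

section EndRings

omit [Preadditive C] in
/-- The idempotent `P.p` of an object of the Karoubi envelope, as an idempotent of the ring `End_C(P.X)`. [cite: AndreKahn2002Nilpotence, §1.2.2] -/
theorem isIdempotentElem_karoubi_p (P : Karoubi C) : IsIdempotentElem (End.of P.p) := P.idem

/-- **ANDRÉ–KAHN §1.2.2: `𝒜♮((A,e),(A,e)) = e𝒜(A,A)e` — the endomorphism ring of `P = (X, p)` in the Karoubi envelope is the CORNER ring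
`p · End_C(X) · p`**, `f ↦ f.f`. [cite: AndreKahn2002Nilpotence, §1.2.2] [cite: Shah2023KRS, Def. 3.8] -/
theorem nonempty_end_karoubi_ringEquiv_corner (P : Karoubi C) : Nonempty (End P ≃+* (isIdempotentElem_karoubi_p P).Corner) := by
  refine ⟨{ toFun := fun f => ⟨End.of f.f, (Subsemigroup.mem_corner_iff (isIdempotentElem_karoubi_p P)).2
              ⟨Karoubi.comp_p f, Karoubi.p_comp f⟩⟩
            invFun := fun g => ⟨End.asHom g.1, by
              obtain ⟨h1, h2⟩ := (Subsemigroup.mem_corner_iff (isIdempotentElem_karoubi_p P)).1 g.2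
              have h1' : End.asHom g.1 ≫ P.p = End.asHom g.1 := h1
              have h2' : P.p ≫ End.asHom g.1 = End.asHom g.1 := h2
              rw [h1', h2']⟩
            left_inv := fun f => Karoubi.hom_ext _ _ rfl
            right_inv := fun g => Subtype.ext rfl
            map_mul' := fun f g => Subtype.ext rfl
            map_add' := fun f g => Subtype.ext rfl }⟩

/-- A full and faithful additive functor induces ring isomorphisms `End X ≃+* End (F X)`. [cite: AndreKahn2002Nilpotence, §1.2 (2-functoriality
of the envelopes)] -/
theorem nonempty_end_ringEquiv_of_full_of_faithful {D : Type u'} [Category.{v'} D] [Preadditive D] (F : C ⥤ D) [F.Additive] [F.Full]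
    [F.Faithful] (X : C) : Nonempty (End X ≃+* End (F.obj X)) :=
  ⟨RingEquiv.ofBijective (RingHom.mk' (F.mapEnd X) fun _ _ => F.map_add)
    ⟨fun _ _ h => F.map_injective h, fun g => F.map_surjective g⟩⟩

/-- `End X ≃+* End ((toKaroubi C) X)`. [cite: AndreKahn2002Nilpotence, §1.2.2] -/
theorem nonempty_end_ringEquiv_toKaroubi (X : C) : Nonempty (End X ≃+* End ((toKaroubi C).obj X)) :=
  nonempty_end_ringEquiv_of_full_of_faithful (toKaroubi C) X

/-- **`End P` is semiperfect when `End_C(P.X)` is** (a corner of a semiperfect ring, AF 27.7 = g37-#1; AK 2.3.4 c): semi-primarity passes to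
`𝒜♮`). [cite: AndreKahn2002Nilpotence, §1.2.2, Prop. 2.3.4 c)] [cite: Krause2015KS, Cor. 4.4] -/
theorem isSemiperfectRing_end_karoubi (P : Karoubi C) [IsSemiperfectRing (End P.X)] : IsSemiperfectRing (End P) := by
  obtain ⟨e⟩ := nonempty_end_karoubi_ringEquiv_corner P
  haveI := Literature.RingTheory.Idempotents.Corner.isSemiperfectRing (isIdempotentElem_karoubi_p P)
  exact Literature.RingTheory.Idempotents.isSemiperfectRing_of_ringEquiv e.symm

/-- `End P` is left artinian when `End_C(P.X)` is (corners of artinian rings are artinian, Lam (21.13)). [cite: AndreKahn2002Nilpotence, §1.2.2,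
Prop. 2.3.4 d)] [cite: Lam2001FirstCourse, §21 Cor. (21.13)] -/
theorem isArtinianRing_end_karoubi (P : Karoubi C) [IsArtinianRing (End P.X)] : IsArtinianRing (End P) := by
  obtain ⟨e⟩ := nonempty_end_karoubi_ringEquiv_corner P
  haveI := Literature.RingTheory.Idempotents.Corner.isArtinianRing (isIdempotentElem_karoubi_p P)
  exact e.symm.isArtinianRing

/-- `End P` is semiperfect when `End_C(P.X)` is left artinian. [cite: AndreKahn2002Nilpotence, Prop. 2.3.4 c), d)] [cite: Krause2015KS, Cor. 4.4] -/
theorem isSemiperfectRing_end_karoubi_of_isArtinianRing (P : Karoubi C) [IsArtinianRing (End P.X)] : IsSemiperfectRing (End P) :=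
  haveI := isArtinianRing_end_karoubi P
  Literature.RingTheory.Idempotents.isSemiperfectRing_of_isArtinianRing

/-- `Hom`-finite `k`-linear `C`: `End P` is semiperfect when `End_C(P.X)` is finite-dimensional over a field `k`. [cite: Shah2023KRS, Thm. 6.1]
[cite: AndreKahn2002Nilpotence, Prop. 2.3.4 c), d)] -/
theorem isSemiperfectRing_end_karoubi_of_finite (k : Type*) [Field k] [Linear k C] (P : Karoubi C) [Module.Finite k (End P.X)] :
    IsSemiperfectRing (End P) :=
  haveI : IsArtinianRing (End P.X) := IsArtinianRing.of_finite k (End P.X)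
  isSemiperfectRing_end_karoubi_of_isArtinianRing P

/-- `End ((toKaroubi C) X)` is semiperfect when `End X` is. [cite: AndreKahn2002Nilpotence, §1.2.2, Prop. 2.3.4 c)] -/
theorem isSemiperfectRing_end_toKaroubi (X : C) [IsSemiperfectRing (End X)] : IsSemiperfectRing (End ((toKaroubi C).obj X)) := by
  obtain ⟨e⟩ := nonempty_end_ringEquiv_toKaroubi X
  exact Literature.RingTheory.Idempotents.isSemiperfectRing_of_ringEquiv e

end EndRings

/-! ## §2 Krull–Remak–Schmidt decompositions in the Karoubi envelope -/

section KRS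

variable [HasFiniteBiproducts C] [HasBinaryBiproducts (Karoubi C)]

/-- **KRULL–REMAK–SCHMIDT IN THE KAROUBI ENVELOPE**: an object `P = (X, p)` of `Karoubi C` whose ambient endomorphism ring `End_C(X)` is
semiperfect is a finite biproduct of indecomposable objects with local endomorphism rings, and any two decompositions of `P` into
indecomposables are equivalent (Krause Cor. 4.4: `Karoubi C` has split idempotents and `End P = p End(X) p` is semiperfect).
[cite: Krause2015KS, Cor. 4.4, Thm. 4.2] [cite: AndreKahn2002Nilpotence, §1.2.2, Prop. 2.3.4 c)] -/
theorem krullRemakSchmidt_karoubi (P : Karoubi C) [IsSemiperfectRing (End P.X)] :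
    (∃ (n : ℕ) (Y : Fin n → Karoubi C), Nonempty (P ≅ ⨁ Y) ∧ ∀ j, Indecomposable (Y j) ∧ IsLocalRing (End (Y j))) ∧
      ∀ {r s : ℕ} {Xs : Fin r → Karoubi C} {Ys : Fin s → Karoubi C}, Nonempty (P ≅ ⨁ Xs) → Nonempty (P ≅ ⨁ Ys) →
        (∀ j, Indecomposable (Xs j)) → (∀ k, Indecomposable (Ys k)) →
          r = s ∧ ∃ σ : Fin r ≃ Fin s, ∀ j, Nonempty (Xs j ≅ Ys (σ j)) :=
  haveI := isSemiperfectRing_end_karoubi P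
  krullRemakSchmidt_of_isSemiperfectRing P

/-- The same for `End_C(P.X)` left artinian (AK 2.3.4 d)). [cite: Krause2015KS, Cor. 4.4, Thm. 4.2] [cite: AndreKahn2002Nilpotence, Prop. 2.3.4 c), d)] -/
theorem krullRemakSchmidt_karoubi_of_isArtinianRing (P : Karoubi C) [IsArtinianRing (End P.X)] :
    (∃ (n : ℕ) (Y : Fin n → Karoubi C), Nonempty (P ≅ ⨁ Y) ∧ ∀ j, Indecomposable (Y j) ∧ IsLocalRing (End (Y j))) ∧
      ∀ {r s : ℕ} {Xs : Fin r → Karoubi C} {Ys : Fin s → Karoubi C}, Nonempty (P ≅ ⨁ Xs) → Nonempty (P ≅ ⨁ Ys) →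
        (∀ j, Indecomposable (Xs j)) → (∀ k, Indecomposable (Ys k)) →
          r = s ∧ ∃ σ : Fin r ≃ Fin s, ∀ j, Nonempty (Xs j ≅ Ys (σ j)) :=
  haveI := isSemiperfectRing_end_karoubi_of_isArtinianRing P
  krullRemakSchmidt_of_isSemiperfectRing P

/-- **«The pseudo-abelian envelope of a `Hom`-finite `k`-linear additive category is Krull–Schmidt», object-wise**: `End_C(P.X)`
finite-dimensional over a field. [cite: Shah2023KRS, Thm. 6.1] [cite: Krause2015KS, Cor. 4.4] [cite: AndreKahn2002Nilpotence, Prop. 2.3.4 c), d)] -/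
theorem krullRemakSchmidt_karoubi_of_finite (k : Type*) [Field k] [Linear k C] (P : Karoubi C) [Module.Finite k (End P.X)] :
    (∃ (n : ℕ) (Y : Fin n → Karoubi C), Nonempty (P ≅ ⨁ Y) ∧ ∀ j, Indecomposable (Y j) ∧ IsLocalRing (End (Y j))) ∧
      ∀ {r s : ℕ} {Xs : Fin r → Karoubi C} {Ys : Fin s → Karoubi C}, Nonempty (P ≅ ⨁ Xs) → Nonempty (P ≅ ⨁ Ys) →
        (∀ j, Indecomposable (Xs j)) → (∀ k, Indecomposable (Ys k)) →
          r = s ∧ ∃ σ : Fin r ≃ Fin s, ∀ j, Nonempty (Xs j ≅ Ys (σ j)) :=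
  haveI := isSemiperfectRing_end_karoubi_of_finite k P
  krullRemakSchmidt_of_isSemiperfectRing P

omit [HasFiniteBiproducts C] in
/-- In `Karoubi C`, an object with `End_C(P.X)` semiperfect is indecomposable iff its endomorphism ring is local (Shah Thm. 6.1 (3)).
[cite: Shah2023KRS, Thm. 6.1] [cite: Krause2015KS, Cor. 4.4] -/
theorem indecomposable_iff_isLocalRing_end_karoubi (P : Karoubi C) [IsSemiperfectRing (End P.X)] :
    Indecomposable P ↔ IsLocalRing (End P) :=
  haveI := isSemiperfectRing_end_karoubi P
  indecomposable_iff_isLocalRing_end_of_isSemiperfectRing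

omit [HasFiniteBiproducts C] in
/-- Artinian form of the previous statement. [cite: Shah2023KRS, Thm. 6.1] -/
theorem indecomposable_iff_isLocalRing_end_karoubi_of_isArtinianRing (P : Karoubi C) [IsArtinianRing (End P.X)] :
    Indecomposable P ↔ IsLocalRing (End P) :=
  haveI := isSemiperfectRing_end_karoubi_of_isArtinianRing P
  indecomposable_iff_isLocalRing_end_of_isSemiperfectRing

/-- **Every object of `C` with semiperfect endomorphism ring SPLITS in the Karoubi envelope into indecomposables with local endomorphism
rings** (this is what the envelope is for: the idempotents of `End X` become summands). [cite: AndreKahn2002Nilpotence, §1.1 («scindage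
d'idempotents»), §1.2.2] [cite: Krause2015KS, Cor. 4.4] -/
theorem exists_iso_biproduct_indecomposable_toKaroubi (X : C) [IsSemiperfectRing (End X)] :
    ∃ (n : ℕ) (Y : Fin n → Karoubi C), Nonempty ((toKaroubi C).obj X ≅ ⨁ Y) ∧ ∀ j, Indecomposable (Y j) ∧ IsLocalRing (End (Y j)) :=
  haveI := isSemiperfectRing_end_toKaroubi X
  exists_iso_biproduct_indecomposable_of_isSemiperfectRing _

omit [HasBinaryBiproducts (Karoubi C)] in
/-- The number of indecomposable summands of `(X, 1)` in the Karoubi envelope is the number of terms in any decomposition of `1 ∈ End X`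
into orthogonal local idempotents (both are Krull–Schmidt invariants): a decomposition `1 = e₀ + ⋯ + e_{n−1}` with local corners yields
`(X,1) ≅ ⨁_{j<n} Yⱼ` with local `End(Yⱼ)`. [cite: Krause2015KS, Prop. 4.1, Cor. 4.4] [cite: AndreKahn2002Nilpotence, §1.2.2] -/
theorem exists_iso_biproduct_toKaroubi_of_completeOrthogonalIdempotents (X : C) {n : ℕ} {e : Fin n → End X}
    (he : CompleteOrthogonalIdempotents e) (hloc : ∀ j, IsLocalRing (he.idem j).Corner) :
    ∃ Y : Fin n → Karoubi C, Nonempty ((toKaroubi C).obj X ≅ ⨁ Y) ∧ ∀ j, IsLocalRing (End (Y j)) := by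
  obtain ⟨φ⟩ := nonempty_end_ringEquiv_toKaroubi X
  -- transport the idempotents along `End X ≃+* End (X, 1)`
  have he' : CompleteOrthogonalIdempotents (φ ∘ e) := he.map φ.toRingHom
  have hloc' : ∀ j, IsLocalRing (he'.idem j).Corner := fun j => by
    haveI := hloc j
    exact Literature.RingTheory.Idempotents.Corner.isLocalRing_corner_map_of_isLocalRing (he.idem j) φ.toRingHom φ.surjective
      (by simpa using Literature.RingTheory.Idempotents.ne_zero_of_isLocalRing_corner (he.idem j))
  exact exists_iso_biproduct_isLocalRing_end_of_completeOrthogonalIdempotents he' hloc'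

end KRS

/-! ## §3 Evans cancellation in the Karoubi envelope -/

section Cancellation

variable [HasBinaryBiproducts (Karoubi C)] {P Q Q' : Karoubi C}

/-- **Cancellation in `Karoubi C`**: `P ⊞ Q ≅ P ⊞ Q′` with `End_C(P.X)` semiperfect ⟹ `Q ≅ Q′` (Evans, g37-#4: `End P` is semiperfect, hence
semilocal of left stable range 1). [cite: Lam2001FirstCourse, §20 Thm. (20.11)] [cite: Krause2015KS, Cor. 4.3] -/
theorem nonempty_iso_of_biprod_iso_biprod_karoubi [IsSemiperfectRing (End P.X)] (φ : P ⊞ Q ≅ P ⊞ Q') : Nonempty (Q ≅ Q') :=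
  haveI := isSemiperfectRing_end_karoubi P
  nonempty_iso_of_biprod_iso_biprod_of_isSemiperfectRing_end φ

/-- Artinian form: `End_C(P.X)` left artinian. [cite: Lam2001FirstCourse, §20 Thm. (20.11), Cor. (20.12)] -/
theorem nonempty_iso_of_biprod_iso_biprod_karoubi_of_isArtinianRing [IsArtinianRing (End P.X)] (φ : P ⊞ Q ≅ P ⊞ Q') :
    Nonempty (Q ≅ Q') :=
  haveI := isSemiperfectRing_end_karoubi_of_isArtinianRing P
  nonempty_iso_of_biprod_iso_biprod_of_isSemiperfectRing_end φ

/-- `Hom`-finite form: `End_C(P.X)` finite-dimensional over a field. [cite: Lam2001FirstCourse, §20 Cor. (20.12)] [cite: Shah2023KRS, Thm. 6.1] -/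
theorem nonempty_iso_of_biprod_iso_biprod_karoubi_of_finite (k : Type*) [Field k] [Linear k C] [Module.Finite k (End P.X)]
    (φ : P ⊞ Q ≅ P ⊞ Q') : Nonempty (Q ≅ Q') :=
  haveI := isSemiperfectRing_end_karoubi_of_finite k P
  nonempty_iso_of_biprod_iso_biprod_of_isSemiperfectRing_end φ

end Cancellation

/-! ## §4 `toKaroubi` reflects isomorphism classes and indecomposability -/

section Reflect

/-- `toKaroubi C` has ZERO kernel on endomorphisms (it is faithful), in the nil-kernel format of g37-#3. [cite: AndreKahn2002Nilpotence, §1.2.2] -/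
theorem nilKernel_toKaroubi (X : C) (f : X ⟶ X) (hf : (toKaroubi C).map f = 0) : IsNilpotent (End.of f) :=
  ⟨1, by rw [pow_one]; exact (toKaroubi C).map_injective (by rw [hf]; exact ((toKaroubi C).map_zero X X).symm)⟩

/-- `X ≅ Y` in `C` iff `(X, 1) ≅ (Y, 1)` in `Karoubi C`. [cite: AndreKahn2002Nilpotence, §1.2.2, Prop. 1.4.4 b)] -/
theorem nonempty_iso_iff_toKaroubi (X Y : C) : Nonempty (X ≅ Y) ↔ Nonempty ((toKaroubi C).obj X ≅ (toKaroubi C).obj Y) :=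
  nonempty_iso_iff (F := toKaroubi C) (nilKernel_toKaroubi X) (nilKernel_toKaroubi Y)

variable [HasBinaryBiproducts C] [HasBinaryBiproducts (Karoubi C)]

/-- If `(X, 1)` is indecomposable in the Karoubi envelope then `X` is indecomposable in `C`. [cite: AndreKahn2002Nilpotence, §1.2.2]
[cite: Shah2023KRS, Def. 4.3, Def. 3.8] -/
theorem indecomposable_of_indecomposable_toKaroubi (X : C) (h : Indecomposable ((toKaroubi C).obj X)) : Indecomposable X :=
  indecomposable_of_indecomposable_obj (F := toKaroubi C) (nilKernel_toKaroubi X) h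

/-- When `C` already has split idempotents, `X` is indecomposable iff `(X, 1)` is. [cite: Shah2023KRS, Def. 3.8, Prop. 3.11]
[cite: AndreKahn2002Nilpotence, §1.2.2] -/
theorem indecomposable_iff_indecomposable_toKaroubi [IsIdempotentComplete C] (X : C) :
    Indecomposable X ↔ Indecomposable ((toKaroubi C).obj X) :=
  indecomposable_iff_indecomposable_obj (F := toKaroubi C) (nilKernel_toKaroubi X)

end Reflect

end Literature.CategoryTheory.KrullSchmidt
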